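import Literature.AlgebraicGeometry.Motives.HodgeStructureK3TypeAdjointProofs
import Literature.AlgebraicGeometry.ComplexMultiplication.JointEigenvectorsOfSemisimpleAction
import HarnessLib

/-!
# Hodge endomorphisms commuting with their polarization-adjoint are semisimple

Layer `Literature/AlgebraicGeometry/Motives`; sequel to `HodgeStructureK3TypeAdjointProofs` (non-degeneracy
of a polarization `ψ` of a pure `ℚ`-Hodge structure `H` on `V`, base change of `ψ`-adjoint pairs, Huybrechts'
Lemma 3.3.12 «the adjoint of a Hodge endomorphism is a Hodge endomorphism»).  THEOREMS ONLY — no definition,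
no named fact, sorry-free (D-0026).  Written for the cell `pub-hodgecm2` (COR-CM, route R-A «Alb(P_Γ) is of
CM-type»): it is the DOOR to the semisimplicity hypothesis `hss : ∀ a, (act a).IsSemisimple` of
`HodgeTheory.isOfCMType_of_forall_eigensystem_oneType_of_isSemisimple` /
`Motives.Jacobian.isOfCMType_of_forall_eigensystem_oneType_of_isSemisimple` for algebras of correspondences
(Hecke algebras) that are commutative and stable under the adjoint (Rosati) involution of a polarization.

## The mathematics

Let `(V, H)` be a pure `ℚ`-Hodge structure of weight `n` with a polarization `ψ` (Hodge–Riemann: the Hodge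
decomposition `V_ℂ = ⊕ V^{p,q}` is `ψ_ℂ(·, conj ·)`-orthogonal and `i^{p-q} ψ_ℂ(x, conj x) > 0` on
`V^{p,q} ∖ 0`), and let `f` be a Hodge endomorphism (`f ∈ End_Hdg(V) = H.endAlg`) admitting a `ψ`-ADJOINT `g`
(`ψ(f v, w) = ψ(v, g w)`) which COMMUTES with `f` — «`f` is `ψ`-normal»; e.g. `f` `ψ`-symmetric (`g = f`),
`ψ`-skew (`g = -f`), or `f` in a commutative `ψ`-adjoint-stable algebra of Hodge endomorphisms.  Then

* `ker f² = ker f` (`Polarization.ker_mul_self_eq_ker`), hence `f` nilpotent `⇒ f = 0`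
  (`Polarization.eq_zero_of_isNilpotent`): on each piece `V^{p,q}` (stable under `f_ℂ`, `g_ℂ`) the form
  `h(x, y) = i^{p-q} ψ_ℂ(x, conj y)` is definite and `h(f_ℂ x, y) = h(x, g_ℂ y)`, `h(g_ℂ x, y) = h(x, f_ℂ y)`, so
  `f_ℂ² x = 0` gives `h(g_ℂ f_ℂ x, g_ℂ f_ℂ x) = h(f_ℂ x, f_ℂ g_ℂ f_ℂ x) = h(f_ℂ x, g_ℂ f_ℂ² x) = 0`, i.e.
  `g_ℂ f_ℂ x = 0`, and then `h(f_ℂ x, f_ℂ x) = h(x, g_ℂ f_ℂ x) = 0`, i.e. `f_ℂ x = 0` — the finite-dimensional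
  «a normal nilpotent operator vanishes», read piece by piece; only the NON-VANISHING `ψ_ℂ(x, conj x) ≠ 0` on
  `V^{p,q} ∖ 0` (`Polarization.form_conj_ne_zero`) is used, never a sign;
* consequently a commutative `ℚ`-subalgebra `S ⊆ End_Hdg(V)` stable under `ψ`-adjoints is REDUCED
  (`Polarization.isReduced_of_forall_exists_isAdjointPair`) and — `V` finite-dimensional — each of its elements
  is a SEMISIMPLE endomorphism of `V` (`Polarization.isSemisimple_of_mem`; an element of a reduced finite
  `ℚ`-algebra has square-free minimal polynomial, `ComplexMultiplication.isSemisimple_apply_of_isReduced`); the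
  same for a commutative `ℚ`-algebra `R` acting by `act : R →ₐ[ℚ] End_ℚ V` through Hodge endomorphisms with
  adjoints in the image (`Polarization.apply_eq_zero_of_isNilpotent_apply`, `Polarization.isSemisimple_apply` —
  the `hss` door), and for one `ψ`-normal / `ψ`-symmetric / `ψ`-skew Hodge endomorphism
  (`Polarization.isSemisimple_of_isAdjointPair_of_commute`, `…_self`, `…_neg`).

This is the Hodge-theoretic core of the classical facts «the Rosati involution of a polarised abelian variety is
the adjoint for the Riemann form and is positive» (Lange, Prop. 2.4.2, Thm. 2.4.9; Mumford §21) ⇒ «symmetric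
endomorphisms, and commutative Rosati-stable subalgebras of `End⁰(X)`, act semisimply on `H¹`» — here for
polarised Hodge structures of any weight, with positivity replaced by the second Hodge–Riemann relation.  The
formulation (ψ-normal Hodge endomorphisms) is ours; the sources below are the printed ingredients.

## Sources

* D. Huybrechts, *Lectures on K3 Surfaces* (2016), §3.3.5 eq. (3.3) and Lemma 3.3.12 (the adjoint `a ↦ a'`,
  `⟨a v, w⟩ = ⟨v, a' w⟩`; «If `a ∈ K`, then `a' ∈ K`»).
* C. Voisin, *Hodge Theory and Complex Algebraic Geometry I* (2002), §7.1.2 Def. 7.7 (Hodge–Riemann bilinear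
  relations: orthogonality of the Hodge decomposition for `Q(x, conj y)`, definiteness on each `V^{p,q}`).
* H. Lange, *Abelian Varieties over the Complex Numbers* (2023), §2.4.1 Prop. 2.4.2 (the Rosati involution is
  the adjoint operator for `E` and `H`), Thm. 2.4.9 (positivity), §2.4.3 (`End_ℚ(X)` is semisimple).
* D. Mumford, *Abelian Varieties* (1970), §21 (positivity of the Rosati involution), §19 Cor. of Thm. 1.

## References

* [Huybrechts2016K3] D. Huybrechts, *Lectures on K3 Surfaces*, CUP 2016, §3.3.5, Lemma 3.3.12.
* [VoisinHodgeI2002] C. Voisin, *Hodge Theory and Complex Algebraic Geometry I*, CUP 2002, §7.1.2 Def. 7.7.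
* [Lange2023AbelianVarietiesC] H. Lange, *Abelian Varieties over the Complex Numbers*, Springer 2023, §2.4.1
  Prop. 2.4.2, Thm. 2.4.9.
* [MumfordAV1970] D. Mumford, *Abelian Varieties*, OUP 1970, §19, §21.
-/

open scoped TensorProduct

noncomputable section

namespace Literature.AlgebraicGeometry.Motives

namespace HodgeStructure

universe u

variable {V : Type u} [AddCommGroup V] [Module ℚ V] {n : ℤ} {H : HodgeStructure V n}

/-! ### §1 Adjoint pairs read on the complexification against `conj` -/

/-- `ψ_ℂ(f_ℂ u, conj v) = ψ_ℂ(u, conj (g_ℂ v))` for a `ψ`-adjoint pair `(f, g)`: base change of the adjoint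
relation (`isAdjointPair_baseChange`) and `conj ∘ g_ℂ = g_ℂ ∘ conj` (`g` is defined over `ℚ`). [folklore] -/
private theorem form_baseChange_conj_right (ψ : Polarization H) {f g : Module.End ℚ V}
    (hfg : LinearMap.IsAdjointPair ψ.form ψ.form f g) (u v : ℂ ⊗[ℚ] V) :
    ψ.form.baseChange ℂ (f.baseChange ℂ u) (conj v) =
      ψ.form.baseChange ℂ u (conj (g.baseChange ℂ v)) := by
  rw [isAdjointPair_baseChange hfg, ← conj_baseChange]

/-- `ψ_ℂ(g_ℂ u, conj v) = ψ_ℂ(u, conj (f_ℂ v))` for a `ψ`-adjoint pair `(f, g)`: the REVERSED reading, from the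
`(-1)ⁿ`-symmetry `ψ_ℂ(y, x) = (-1)ⁿ ψ_ℂ(x, y)` (`Polarization.form_baseChange_swap`) applied twice,
`((-1)ⁿ)² = 1`. [folklore] -/
private theorem form_baseChange_conj_left (ψ : Polarization H) {f g : Module.End ℚ V}
    (hfg : LinearMap.IsAdjointPair ψ.form ψ.form f g) (u v : ℂ ⊗[ℚ] V) :
    ψ.form.baseChange ℂ (g.baseChange ℂ u) (conj v) =
      ψ.form.baseChange ℂ u (conj (f.baseChange ℂ v)) := by
  have hε : ((((n.negOnePow : ℤˣ) : ℤ) : ℂ)) * (((n.negOnePow : ℤˣ) : ℤ) : ℂ) = 1 := by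
    rw [← Int.cast_mul, ← Units.val_mul, Int.units_mul_self, Units.val_one, Int.cast_one]
  rw [ψ.form_baseChange_swap (conj v) (g.baseChange ℂ u), ← isAdjointPair_baseChange hfg,
    conj_baseChange, ψ.form_baseChange_swap u, ← mul_assoc, hε, one_mul]

/-! ### §2 `ker f² = ker f` for a `ψ`-normal Hodge endomorphism -/

/-- **On one Hodge piece.** Let `f ∈ End_Hdg(V)` have a `ψ`-adjoint `g` commuting with `f`, and let
`x ∈ V^{p,q}` (`p + q = n`) with `f_ℂ² x = 0`.  Then `f_ℂ x = 0`.  Proof: `g` is a Hodge endomorphism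
(Huybrechts Lemma 3.3.12), so `f_ℂ x`, `w := g_ℂ f_ℂ x` lie in `V^{p,q}`; `ψ_ℂ(w, conj w) =
ψ_ℂ(f_ℂ x, conj (f_ℂ g_ℂ f_ℂ x)) = ψ_ℂ(f_ℂ x, conj (g_ℂ f_ℂ² x)) = 0`, hence `w = 0` by the second Hodge–Riemann
relation (`ψ_ℂ(w, conj w) ≠ 0` for `w ≠ 0` in `V^{p,q}`), and then `ψ_ℂ(f_ℂ x, conj f_ℂ x) = ψ_ℂ(x, conj w) = 0`
forces `f_ℂ x = 0` — the step «a normal nilpotent operator on a definite space vanishes», with definiteness =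
Hodge–Riemann on `V^{p,q}` and adjointness = Rosati/Huybrechts' `⟨a v, w⟩ = ⟨v, a' w⟩`.
[cite: VoisinHodgeI2002, §7.1.2 Def. 7.7] [cite: Huybrechts2016K3, §3.3.5 eq. (3.3) and Lemma 3.3.12]
[cite: Lange2023AbelianVarietiesC, §2.4.1 Prop. 2.4.2 and Thm. 2.4.9] -/
theorem Polarization.baseChange_apply_eq_zero_of_mem_piece (ψ : Polarization H) {f g : Module.End ℚ V}
    (hf : f ∈ H.endAlg) (hfg : LinearMap.IsAdjointPair ψ.form ψ.form f g) (hc : Commute f g)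
    {p q : ℤ} (hpq : p + q = n) {x : ℂ ⊗[ℚ] V} (hx : x ∈ H.piece p q)
    (h2 : f.baseChange ℂ (f.baseChange ℂ x) = 0) : f.baseChange ℂ x = 0 := by
  have hg : g ∈ H.endAlg := ψ.mem_endAlg_of_isAdjointPair hf hfg
  have hFG : ∀ y, f.baseChange ℂ (g.baseChange ℂ y) = g.baseChange ℂ (f.baseChange ℂ y) := fun y => by
    have h := congrArg (fun e : Module.End ℚ V => e.baseChange ℂ y) hc.eq
    simpa only [Module.End.mul_eq_comp, LinearMap.baseChange_comp, LinearMap.comp_apply] using h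
  have hFx : f.baseChange ℂ x ∈ H.piece p q := endAlg.baseChange_mem_piece ⟨f, hf⟩ hx
  have hw : g.baseChange ℂ (f.baseChange ℂ x) ∈ H.piece p q := endAlg.baseChange_mem_piece ⟨g, hg⟩ hFx
  -- `w := g_ℂ f_ℂ x = 0`
  have hw0 : g.baseChange ℂ (f.baseChange ℂ x) = 0 := by
    by_contra hne
    refine ψ.form_conj_ne_zero hpq hw hne ?_
    rw [form_baseChange_conj_left ψ hfg, hFG, h2, map_zero, map_zero, map_zero]
  -- `f_ℂ x = 0`
  by_contra hne
  refine ψ.form_conj_ne_zero hpq hFx hne ?_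
  rw [form_baseChange_conj_right ψ hfg, hw0, map_zero, map_zero]

/-- **On the whole complexification.** For `f ∈ End_Hdg(V)` with a `ψ`-adjoint `g` commuting with `f`:
`f_ℂ² x = 0 ⇒ f_ℂ x = 0` for every `x ∈ V_ℂ`.  Write `x = Σ_p x_p` along the Hodge decomposition
(`V_ℂ = ⊕ V^{p,n-p}`, Deligne, Hodge II, 1.2.5); `f_ℂ` preserves every piece and the pieces are independent,
so `f_ℂ² x_p = 0` for every `p`, and `baseChange_apply_eq_zero_of_mem_piece` applies piecewise (induction on
the finite set of Hodge types occurring in `x`). [cite: VoisinHodgeI2002, §7.1.2 Def. 7.7]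
[cite: Huybrechts2016K3, Lemma 3.3.12] -/
theorem Polarization.baseChange_apply_eq_zero_of_sq (ψ : Polarization H) {f g : Module.End ℚ V}
    (hf : f ∈ H.endAlg) (hfg : LinearMap.IsAdjointPair ψ.form ψ.form f g) (hc : Commute f g)
    {x : ℂ ⊗[ℚ] V} (h2 : f.baseChange ℂ (f.baseChange ℂ x) = 0) : f.baseChange ℂ x = 0 := by
  have hmem : x ∈ ⨆ p : ℤ, H.piece p (n - p) := by
    rw [iSup_piece_eq_top_holds H]; exact Submodule.mem_top
  obtain ⟨s, hs⟩ := Submodule.mem_iSup_iff_exists_finset.1 hmem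
  have hFbi : ∀ (t : Finset ℤ) {z : ℂ ⊗[ℚ] V}, (z ∈ ⨆ p ∈ t, H.piece p (n - p)) →
      f.baseChange ℂ z ∈ ⨆ p ∈ t, H.piece p (n - p) := fun t z hz =>
    (endAlg.toHom ⟨f, hf⟩).baseChange_mem_biSup_piece hz
  suffices key : ∀ (t : Finset ℤ) (z : ℂ ⊗[ℚ] V), (z ∈ ⨆ p ∈ t, H.piece p (n - p)) →
      f.baseChange ℂ (f.baseChange ℂ z) = 0 → f.baseChange ℂ z = 0 from key s x hs h2
  intro t
  induction t using Finset.induction_on with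
  | empty =>
    intro z hz _
    have hz0 : z = 0 := by simpa using hz
    rw [hz0, map_zero]
  | insert a t hat ih =>
    intro z hz hzz
    rw [Finset.iSup_insert, Submodule.mem_sup] at hz
    obtain ⟨y, hy, w, hw, rfl⟩ := hz
    have hFFy : f.baseChange ℂ (f.baseChange ℂ y) ∈ H.piece a (n - a) :=
      endAlg.baseChange_mem_piece ⟨f, hf⟩ (endAlg.baseChange_mem_piece ⟨f, hf⟩ hy)
    have hFFw : f.baseChange ℂ (f.baseChange ℂ w) ∈ ⨆ p ∈ t, H.piece p (n - p) := hFbi t (hFbi t hw)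
    have hsum : f.baseChange ℂ (f.baseChange ℂ y) + f.baseChange ℂ (f.baseChange ℂ w) = 0 := by
      rwa [map_add, map_add] at hzz
    have hFFy0 : f.baseChange ℂ (f.baseChange ℂ y) = 0 := by
      have hneg : f.baseChange ℂ (f.baseChange ℂ y) = -f.baseChange ℂ (f.baseChange ℂ w) :=
        eq_neg_of_add_eq_zero_left hsum
      have hmem' : f.baseChange ℂ (f.baseChange ℂ y) ∈ ⨆ p ∈ t, H.piece p (n - p) := by
        rw [hneg]; exact Submodule.neg_mem _ hFFw
      exact (Submodule.disjoint_def.1 (disjoint_piece_biSup H hat)) _ hFFy hmem'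
    have hFFw0 : f.baseChange ℂ (f.baseChange ℂ w) = 0 := by
      rwa [hFFy0, zero_add] at hsum
    rw [map_add, ψ.baseChange_apply_eq_zero_of_mem_piece hf hfg hc (by omega) hy hFFy0,
      ih w hw hFFw0, add_zero]

/-- **`ker f² = ker f` for a `ψ`-normal Hodge endomorphism** (`f ∈ End_Hdg(V)` with a `ψ`-adjoint `g`,
`f g = g f`): from the complexified statement `baseChange_apply_eq_zero_of_sq` at `x = 1 ⊗ v` and the
injectivity of `v ↦ 1 ⊗ v`. [cite: VoisinHodgeI2002, §7.1.2 Def. 7.7] [cite: Huybrechts2016K3, Lemma 3.3.12]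
[cite: Lange2023AbelianVarietiesC, §2.4.1 Prop. 2.4.2 and Thm. 2.4.9] -/
theorem Polarization.ker_mul_self_eq_ker (ψ : Polarization H) {f g : Module.End ℚ V}
    (hf : f ∈ H.endAlg) (hfg : LinearMap.IsAdjointPair ψ.form ψ.form f g) (hc : Commute f g) :
    LinearMap.ker (f * f) = LinearMap.ker f := by
  refine le_antisymm (fun v hv => ?_) (fun v hv => ?_)
  · rw [LinearMap.mem_ker] at hv ⊢
    have h1 : f.baseChange ℂ (f.baseChange ℂ (ofRat v)) = 0 := by
      rw [ofRat_apply, LinearMap.baseChange_tmul, LinearMap.baseChange_tmul, ← Module.End.mul_apply, hv,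
        TensorProduct.tmul_zero]
    have h2 := ψ.baseChange_apply_eq_zero_of_sq hf hfg hc h1
    rw [ofRat_apply, LinearMap.baseChange_tmul] at h2
    exact ofRat_injective (V := V) (by rw [ofRat_apply, h2, map_zero])
  · rw [LinearMap.mem_ker] at hv ⊢
    rw [Module.End.mul_apply, hv, map_zero]

/-- **A nilpotent `ψ`-normal Hodge endomorphism vanishes**: if `f ∈ End_Hdg(V)` has a `ψ`-adjoint `g`
commuting with `f` and `fᵐ = 0`, then `f = 0` (`ker f^{k+1} = ker f` for all `k`, from `ker f² = ker f`).  The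
Hodge-structure form of «an algebra with a positive involution has no non-zero normal nilpotents» (Rosati
positivity, Lange Thm. 2.4.9 / Mumford §21). [cite: Lange2023AbelianVarietiesC, §2.4.1 Thm. 2.4.9]
[cite: MumfordAV1970, §21] [cite: Huybrechts2016K3, Lemma 3.3.12] -/
theorem Polarization.eq_zero_of_isNilpotent (ψ : Polarization H) {f g : Module.End ℚ V}
    (hf : f ∈ H.endAlg) (hfg : LinearMap.IsAdjointPair ψ.form ψ.form f g) (hc : Commute f g)
    (hn : IsNilpotent f) : f = 0 := by
  obtain ⟨m, hm⟩ := hn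
  have hker := ψ.ker_mul_self_eq_ker hf hfg hc
  have key : ∀ k : ℕ, LinearMap.ker (f ^ (k + 1)) = LinearMap.ker f := by
    intro k
    induction k with
    | zero => rw [zero_add, pow_one]
    | succ k ih =>
      refine le_antisymm (fun v hv => ?_) (fun v hv => ?_)
      · have h1 : f v ∈ LinearMap.ker (f ^ (k + 1)) := by
          rw [LinearMap.mem_ker] at hv ⊢
          rwa [pow_succ, Module.End.mul_apply] at hv
        rw [ih, LinearMap.mem_ker, ← Module.End.mul_apply, ← LinearMap.mem_ker, hker] at h1
        exact h1
      · rw [LinearMap.mem_ker] at hv ⊢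
        rw [pow_succ, Module.End.mul_apply, hv, map_zero]
  rcases m with _ | k
  · rw [pow_zero] at hm
    calc f = f * 1 := (mul_one f).symm
      _ = 0 := by rw [hm, mul_zero]
  · have htop : LinearMap.ker f = ⊤ := by rw [← key k, hm, LinearMap.ker_zero]
    exact LinearMap.ker_eq_top.1 htop

/-! ### §3 Commutative adjoint-stable algebras of Hodge endomorphisms are reduced, with semisimple elements -/

/-- **A commutative `ψ`-adjoint-stable subalgebra of `End_Hdg(V)` is reduced.**  If `S ⊆ End_Hdg(V)` is a
commutative `ℚ`-subalgebra such that every `a ∈ S` has a `ψ`-adjoint inside `S`, then `S` has no non-zero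
nilpotents (`Polarization.eq_zero_of_isNilpotent`: the adjoint commutes with `a`).  The printed prototype:
the Rosati involution is a positive anti-involution of `End_ℚ(X)` and maps commutative subalgebras such as the
centre onto themselves (Lange Thm. 2.4.9; Mumford §21; Shimura's «the involution maps `K` onto itself»).
[cite: Lange2023AbelianVarietiesC, §2.4.1 Thm. 2.4.9] [cite: MumfordAV1970, §21]
[cite: Huybrechts2016K3, Lemma 3.3.12] -/
theorem Polarization.isReduced_of_forall_exists_isAdjointPair (ψ : Polarization H)
    {S : Subalgebra ℚ (Module.End ℚ V)} (hS : S ≤ H.endAlg)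
    (hcomm : ∀ a ∈ S, ∀ b ∈ S, a * b = b * a)
    (hadj : ∀ a ∈ S, ∃ b ∈ S, LinearMap.IsAdjointPair ψ.form ψ.form a b) : IsReduced S := by
  refine ⟨fun a ha => ?_⟩
  obtain ⟨b, hbS, hab⟩ := hadj a a.2
  exact Subtype.ext (ψ.eq_zero_of_isNilpotent (hS a.2) hab (hcomm a a.2 b hbS) (ha.map S.val))

/-- **Elements of a commutative `ψ`-adjoint-stable subalgebra of `End_Hdg(V)` are semisimple** (`V`
finite-dimensional): `S` is reduced (`isReduced_of_forall_exists_isAdjointPair`) and finite over `ℚ`, so every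
`a ∈ S` has square-free minimal polynomial (`ComplexMultiplication.isSemisimple_apply_of_isReduced`).  In
particular `S ⊗ ℂ ≅ ℂ^N` acts diagonalisably on `V_ℂ` — the shape «`End_ℚ(X)` is a semisimple `ℚ`-algebra»
takes for commutative Rosati-stable subalgebras (Lange §2.4.3; Mumford §19–§21).
[cite: Lange2023AbelianVarietiesC, §2.4.1 Thm. 2.4.9 and §2.4.3] [cite: MumfordAV1970, §21]
[cite: Huybrechts2016K3, Lemma 3.3.12] -/
theorem Polarization.isSemisimple_of_mem [Module.Finite ℚ V] (ψ : Polarization H)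
    {S : Subalgebra ℚ (Module.End ℚ V)} (hS : S ≤ H.endAlg)
    (hcomm : ∀ a ∈ S, ∀ b ∈ S, a * b = b * a)
    (hadj : ∀ a ∈ S, ∃ b ∈ S, LinearMap.IsAdjointPair ψ.form ψ.form a b)
    {a : Module.End ℚ V} (ha : a ∈ S) : a.IsSemisimple := by
  haveI := ψ.isReduced_of_forall_exists_isAdjointPair hS hcomm hadj
  haveI : Module.Finite ℚ S := Module.Finite.of_injective S.val.toLinearMap Subtype.val_injective
  exact ComplexMultiplication.isSemisimple_apply_of_isReduced S.val ⟨a, ha⟩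

/-- **No non-zero nilpotents in the image of a commutative algebra acting by Hodge endomorphisms with
adjoints** — the `act` form used by the cell's eigensystem files: `R` commutative, `act : R →ₐ[ℚ] End_ℚ V`
with every `act a ∈ End_Hdg(V)` and every `act a` having a `ψ`-adjoint of the form `act b`; then
`act a` nilpotent `⇒ act a = 0`. (E.g. an algebra of algebraic correspondences stable under transposition,
whose transposes are the `ψ`-adjoints — Rosati.) [cite: Lange2023AbelianVarietiesC, §2.4.1 Prop. 2.4.2 and Thm. 2.4.9]
[cite: MumfordAV1970, §21] [cite: Huybrechts2016K3, Lemma 3.3.12] -/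
theorem Polarization.apply_eq_zero_of_isNilpotent_apply (ψ : Polarization H)
    {R : Type*} [CommRing R] [Algebra ℚ R] (act : R →ₐ[ℚ] Module.End ℚ V)
    (hH : ∀ a, act a ∈ H.endAlg)
    (hadj : ∀ a, ∃ b, LinearMap.IsAdjointPair ψ.form ψ.form (act a) (act b))
    {a : R} (hn : IsNilpotent (act a)) : act a = 0 := by
  obtain ⟨b, hab⟩ := hadj a
  exact ψ.eq_zero_of_isNilpotent (hH a) hab ((Commute.all a b).map act) hn

/-- **The `hss` door: a commutative algebra acting by Hodge endomorphisms with adjoints acts semisimply.**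
For `V` finite-dimensional, `R` commutative and `act : R →ₐ[ℚ] End_ℚ V` with `act a ∈ End_Hdg(V)` and a
`ψ`-adjoint `act b` for every `a`, EVERY `act a` is a semisimple endomorphism of `V`
(`apply_eq_zero_of_isNilpotent_apply` + `ComplexMultiplication.isSemisimple_apply_of_isNilpotent_imp_eq_zero`).
This is verbatim the hypothesis `hss` of `HodgeTheory.isOfCMType_of_forall_eigensystem_oneType_of_isSemisimple`.
[cite: Lange2023AbelianVarietiesC, §2.4.1 Prop. 2.4.2 and Thm. 2.4.9] [cite: MumfordAV1970, §21]
[cite: Huybrechts2016K3, Lemma 3.3.12] -/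
theorem Polarization.isSemisimple_apply [Module.Finite ℚ V] (ψ : Polarization H)
    {R : Type*} [CommRing R] [Algebra ℚ R] (act : R →ₐ[ℚ] Module.End ℚ V)
    (hH : ∀ a, act a ∈ H.endAlg)
    (hadj : ∀ a, ∃ b, LinearMap.IsAdjointPair ψ.form ψ.form (act a) (act b)) (a : R) :
    (act a).IsSemisimple :=
  ComplexMultiplication.isSemisimple_apply_of_isNilpotent_imp_eq_zero act
    (fun _ hb => ψ.apply_eq_zero_of_isNilpotent_apply act hH hadj hb) a

/-! ### §4 One `ψ`-normal Hodge endomorphism -/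

/-- **A `ψ`-normal Hodge endomorphism is semisimple.**  If `f ∈ End_Hdg(V)` (`V` finite-dimensional) has a
`ψ`-adjoint `g` with `f g = g f`, then `f` is a semisimple endomorphism of `V`: the subalgebra `ℚ[f, g]` is
commutative, consists of Hodge endomorphisms (Huybrechts Lemma 3.3.12 for `g`), and is `ψ`-adjoint-stable
(the adjoint of `Σ c f^i g^j` is `Σ c g^i f^j`, using the `(-1)ⁿ`-symmetry of `ψ` for the pair `(g, f)`), so
`isSemisimple_of_mem` applies.  Over `ℂ` this is the spectral theorem for normal operators, read through
Hodge–Riemann. [cite: Lange2023AbelianVarietiesC, §2.4.1 Prop. 2.4.2 and Thm. 2.4.9]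
[cite: Huybrechts2016K3, §3.3.5 eq. (3.3) and Lemma 3.3.12] [cite: VoisinHodgeI2002, §7.1.2 Def. 7.7] -/
theorem Polarization.isSemisimple_of_isAdjointPair_of_commute [Module.Finite ℚ V] (ψ : Polarization H)
    {f g : Module.End ℚ V} (hf : f ∈ H.endAlg) (hfg : LinearMap.IsAdjointPair ψ.form ψ.form f g)
    (hc : Commute f g) : f.IsSemisimple := by
  have hg : g ∈ H.endAlg := ψ.mem_endAlg_of_isAdjointPair hf hfg
  -- the reversed pair `(g, f)`, by the `(-1)ⁿ`-symmetry of `ψ`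
  have hgf : LinearMap.IsAdjointPair ψ.form ψ.form g f := fun x y => by
    have hε : ((((n.negOnePow : ℤˣ) : ℤ) : ℚ)) * (((n.negOnePow : ℤˣ) : ℤ) : ℚ) = 1 := by
      rw [← Int.cast_mul, ← Units.val_mul, Int.units_mul_self, Units.val_one, Int.cast_one]
    rw [ψ.form_swap y (g x), ← hfg y x, ψ.form_swap x (f y), ← mul_assoc, hε, one_mul]
  set S := Algebra.adjoin ℚ ({f, g} : Set (Module.End ℚ V)) with hSdef
  have hfS : f ∈ S := Algebra.subset_adjoin (by simp)
  have hgS : g ∈ S := Algebra.subset_adjoin (by simp)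
  have hS : S ≤ H.endAlg := Algebra.adjoin_le (by
    intro x hx
    simp only [Set.mem_insert_iff, Set.mem_singleton_iff] at hx
    rcases hx with rfl | rfl
    · exact hf
    · exact hg)
  -- the generators commute pairwise, hence so does `ℚ[f, g]`
  have hgen : ∀ a ∈ ({f, g} : Set (Module.End ℚ V)), ∀ b ∈ ({f, g} : Set (Module.End ℚ V)),
      Commute a b := by
    intro a ha b hb
    simp only [Set.mem_insert_iff, Set.mem_singleton_iff] at ha hb
    rcases ha with rfl | rfl <;> rcases hb with rfl | rfl
    · exact Commute.refl _
    · exact hc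
    · exact hc.symm
    · exact Commute.refl _
  have h1 : ∀ b ∈ S, ∀ a ∈ ({f, g} : Set (Module.End ℚ V)), Commute a b := fun b hb a ha =>
    Algebra.commute_of_mem_adjoin_of_forall_mem_commute hb (fun y hy => hgen a ha y hy)
  have hcomm : ∀ a ∈ S, ∀ b ∈ S, a * b = b * a := fun a ha b hb =>
    (Algebra.commute_of_mem_adjoin_of_forall_mem_commute hb (fun x hx => (h1 a ha x hx).symm)).eq
  -- `ℚ[f, g]` is stable under `ψ`-adjoints
  have hadj : ∀ a ∈ S, ∃ b ∈ S, LinearMap.IsAdjointPair ψ.form ψ.form a b := by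
    intro a ha
    induction ha using Algebra.adjoin_induction with
    | mem x hx =>
      simp only [Set.mem_insert_iff, Set.mem_singleton_iff] at hx
      rcases hx with rfl | rfl
      · exact ⟨g, hgS, hfg⟩
      · exact ⟨f, hfS, hgf⟩
    | algebraMap r =>
      refine ⟨algebraMap ℚ (Module.End ℚ V) r, Subalgebra.algebraMap_mem S r, fun x y => ?_⟩
      simp [Module.algebraMap_end_apply]
    | add x y _ _ ihx ihy =>
      obtain ⟨x', hx', hxx'⟩ := ihx
      obtain ⟨y', hy', hyy'⟩ := ihy
      refine ⟨x' + y', add_mem hx' hy', fun u v => ?_⟩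
      simp only [LinearMap.add_apply, map_add, hxx' u v, hyy' u v]
    | mul x y _ _ ihx ihy =>
      obtain ⟨x', hx', hxx'⟩ := ihx
      obtain ⟨y', hy', hyy'⟩ := ihy
      exact ⟨y' * x', mul_mem hy' hx', hxx'.mul hyy'⟩
  exact ψ.isSemisimple_of_mem hS hcomm hadj hfS

/-- **`ψ`-symmetric Hodge endomorphisms are semisimple**: `f ∈ End_Hdg(V)` with `ψ(f v, w) = ψ(v, f w)`
(`V` finite-dimensional) is a semisimple endomorphism — the Hodge-structure form of «symmetric elements for the
Rosati involution act semisimply (with real eigenvalues)» (Lange §2.4; Mumford §20–§21).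
[cite: Lange2023AbelianVarietiesC, §2.4.1 Prop. 2.4.2 and Thm. 2.4.9] [cite: MumfordAV1970, §21]
[cite: Huybrechts2016K3, Lemma 3.3.12] -/
theorem Polarization.isSemisimple_of_isAdjointPair_self [Module.Finite ℚ V] (ψ : Polarization H)
    {f : Module.End ℚ V} (hf : f ∈ H.endAlg) (h : LinearMap.IsAdjointPair ψ.form ψ.form f f) :
    f.IsSemisimple :=
  ψ.isSemisimple_of_isAdjointPair_of_commute hf h (Commute.refl f)

/-- **`ψ`-skew Hodge endomorphisms are semisimple**: `f ∈ End_Hdg(V)` with `ψ(f v, w) = -ψ(v, f w)`, i.e.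
adjoint `-f` (`V` finite-dimensional), is a semisimple endomorphism (e.g. elements of the Lie algebra of the
isometry group of `ψ` that are Hodge endomorphisms). [cite: Lange2023AbelianVarietiesC, §2.4.1 Prop. 2.4.2 and Thm. 2.4.9]
[cite: Huybrechts2016K3, Lemma 3.3.12] -/
theorem Polarization.isSemisimple_of_isAdjointPair_neg [Module.Finite ℚ V] (ψ : Polarization H)
    {f : Module.End ℚ V} (hf : f ∈ H.endAlg) (h : LinearMap.IsAdjointPair ψ.form ψ.form f (-f)) :
    f.IsSemisimple :=
  ψ.isSemisimple_of_isAdjointPair_of_commute hf h (Commute.refl f).neg_right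

/-- **Morphism form.** An endomorphism of Hodge structures `φ : H → H` with a `ψ`-adjoint endomorphism `φ'`
commuting with it has semisimple underlying linear map (`V` finite-dimensional).
[cite: Lange2023AbelianVarietiesC, §2.4.1 Prop. 2.4.2 and Thm. 2.4.9] [cite: Huybrechts2016K3, Lemma 3.3.12] -/
theorem Hom.isSemisimple_of_isAdjointPair_of_commute [Module.Finite ℚ V] (ψ : Polarization H)
    (φ φ' : Hom H H) (h : LinearMap.IsAdjointPair ψ.form ψ.form φ.toLinearMap φ'.toLinearMap)
    (hc : Commute (φ.toLinearMap : Module.End ℚ V) φ'.toLinearMap) :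
    Module.End.IsSemisimple (φ.toLinearMap : Module.End ℚ V) :=
  ψ.isSemisimple_of_isAdjointPair_of_commute φ.toLinearMap_mem_endAlg h hc

end HodgeStructure

end Literature.AlgebraicGeometry.Motives

end
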